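import Summits.QuantumFields.YangMills.Theorems.SwapVirialDeficitSectorLaplaceTipCornerConcrete
import Summits.QuantumFields.YangMills.Theorems.SwapVirialDeficitSectorLaplaceTipMidShellIntegrationIso
import Summits.QuantumFields.YangMills.Theorems.SwapVirialDeficitSectorLaplaceEndGaussPlugRate
import HarnessLib

/-!
# THE TIP OF SKELETON ➎, GLUE CONSTANTS: polynomial-in-`L` bookkeeping of the concrete mid ∕ corner ∕ core constants
# (cell ym-idea-1; free-hands support of ⟨stmt-QuantumFields-24197⟩ `SwapVirialDeficit.SwapGluedStiffness`; inputs of the glue `stub_core_tip_of_core`)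

* `tipR0_le` — w2's sandwich constant `R₀(L) ≤ 3·(19·20400)⁴·7200²·(2·1800²)·L⁵⁶`;
* `tipDeltaR_facts` — `δr(L) ≤ 12·122689728·2304·36·L¹⁸`, `ρO(L)⁻¹ ≤ 12·44712000·2304·36·L¹⁸`;
* `tipShellWeight_ge` — the shell weight `W′(δr, 2δr) ≥ 7/(96·δr³)` (✓`integral_Icc_inv_one_add_sq_sq_ge`), so `W′⁻¹ ≤ (96/7)·δr³`;
* `tipDeltaTau_facts` — `δ_τ = √(τ⁻¹−1)`: for `0 < τ ≤ ½`, `1 ≤ δ_τ`, `δ_τ⁻¹ ≤ √2·τ^{1/2}`, `δ_τ^{−3/4} ≤ 2·τ^{3/8}`.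

HONEST LABEL: real bookkeeping; `stub_core_tip` (hCore multi-seat + glue), ⟨24197⟩ ∕ ⟨24194⟩ OPEN; item of record ⟨24085⟩ `SubOctaveBounded` aside ∕ untouched; the Yang–Mills
mass gap is NOT proved; no summit is proved by a line.  THEOREMS ONLY (0 `def`, 0 `sorry`), standard axioms, no instances.  Seat ym-line-fcl-p3 g49 (cell ym-idea-1,
free hands = ➎ assembler), `--supports stmt-QuantumFields-24197`.  References: [folklore].
-/

set_option autoImplicit false
set_option synthInstance.maxSize 1024

noncomputable section

open MeasureTheory Quaternion Set Module
open scoped Quaternion BigOperators ENNReal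
open Literature.MathematicalPhysics.QuantumLattice
open Literature.MathematicalPhysics.QuantumFieldTheory hiding SU2

namespace Summit.QuantumFields.YangMills.Theorems.SwapVirialDeficit.SectorLaplace

open Summit.QuantumFields.YangMills.Theorems.FemtoTransferGap
open Summit.QuantumFields.YangMills.Theorems.FemtoTransferGap.TT
open Summit.QuantumFields.YangMills.Theorems.SwapVirialDeficit.SwapRing
open Summit.QuantumFields.YangMills.Theorems.SwapVirialDeficit.BlowUpRing

variable {L : ℕ} [NeZero L]

/-- ★ w2 g61's sandwich constant is polynomial: `R₀(L) ≤ 3·(19·20400)⁴·7200²·(2·1800²)·L⁵⁶` (`(1+d) ≤ 19L⁴`, `B^{7/2} ≤ B⁴`, `(√(1/(4·1800L⁶))³)⁻¹ ≤ (7200L⁶)²`). [folklore] -/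
theorem tipR0_le :
    Real.exp 1 * ((1 + (finrank ℝ (GnoFol L) : ℝ)) * (20400 * (L : ℝ) ^ 4)) ^ (7 / 2 : ℝ) *
        (Real.sqrt ((1 / 4 : ℝ) * (1 / (1800 * (L : ℝ) ^ 6))) ^ 3)⁻¹ * (2 * (1800 * (L : ℝ) ^ 6) ^ 2) ≤
      3 * (19 * 20400) ^ 4 * 7200 ^ 2 * (2 * 1800 ^ 2) * (L : ℝ) ^ 56 := by
  obtain ⟨hL1, hc1, hc6, -, -⟩ := cell_sizes (L := L)
  have hL0 : (0 : ℝ) < L := by linarith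
  have hd : (finrank ℝ (GnoFol L) : ℝ) = 3 * (Fintype.card (Fol L) : ℝ) := finrank_gnoFol_real (L := L)
  have hL4 : (1 : ℝ) ≤ (L : ℝ) ^ 4 := one_le_pow₀ hL1
  have hL6 : (1 : ℝ) ≤ (L : ℝ) ^ 6 := one_le_pow₀ hL1
  -- `B^{7/2} ≤ (19·20400)⁴ L³²`
  set B : ℝ := (1 + (finrank ℝ (GnoFol L) : ℝ)) * (20400 * (L : ℝ) ^ 4) with hB
  have hB1 : 1 ≤ B := by
    rw [hB, hd]; nlinarith
  have hBle : B ≤ 19 * 20400 * (L : ℝ) ^ 8 := by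
    rw [hB, hd]
    have h1 : 1 + 3 * (Fintype.card (Fol L) : ℝ) ≤ 19 * (L : ℝ) ^ 4 := by nlinarith
    nlinarith [pow_pos hL0 4]
  have hB72 : B ^ (7 / 2 : ℝ) ≤ (19 * 20400) ^ 4 * (L : ℝ) ^ 32 := by
    have h1 : B ^ (7 / 2 : ℝ) ≤ B ^ (4 : ℝ) := Real.rpow_le_rpow_of_exponent_le hB1 (by norm_num)
    have h2 : B ^ (4 : ℝ) = B ^ (4 : ℕ) := by rw [show (4 : ℝ) = ((4 : ℕ) : ℝ) by norm_num, Real.rpow_natCast]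
    have h3 : B ^ (4 : ℕ) ≤ (19 * 20400 * (L : ℝ) ^ 8) ^ 4 := pow_le_pow_left₀ (by linarith) hBle 4
    calc B ^ (7 / 2 : ℝ) ≤ B ^ (4 : ℕ) := h1.trans h2.le
      _ ≤ (19 * 20400 * (L : ℝ) ^ 8) ^ 4 := h3
      _ = (19 * 20400) ^ 4 * (L : ℝ) ^ 32 := by ring
  -- `(√x ³)⁻¹ ≤ (7200 L⁶)²`, `x = 1/(4·1800L⁶) = (7200L⁶)⁻¹`
  have hx : (1 / 4 : ℝ) * (1 / (1800 * (L : ℝ) ^ 6)) = (7200 * (L : ℝ) ^ 6)⁻¹ := by field_simp; norm_num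
  have hX1 : (1 : ℝ) ≤ 7200 * (L : ℝ) ^ 6 := by nlinarith
  have hs : Real.sqrt ((7200 * (L : ℝ) ^ 6)⁻¹) = (Real.sqrt (7200 * (L : ℝ) ^ 6))⁻¹ := Real.sqrt_inv _
  have hsq1 : 1 ≤ Real.sqrt (7200 * (L : ℝ) ^ 6) := Real.one_le_sqrt.2 hX1
  have hsqle : Real.sqrt (7200 * (L : ℝ) ^ 6) ≤ 7200 * (L : ℝ) ^ 6 := by
    rw [Real.sqrt_le_left (by positivity)]; nlinarith
  have hinv : (Real.sqrt ((1 / 4 : ℝ) * (1 / (1800 * (L : ℝ) ^ 6))) ^ 3)⁻¹ ≤ (7200 * (L : ℝ) ^ 6) ^ 2 := by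
    rw [hx, hs, inv_pow, inv_inv]
    have hsq2 : Real.sqrt (7200 * (L : ℝ) ^ 6) ^ 2 = 7200 * (L : ℝ) ^ 6 := Real.sq_sqrt (by positivity)
    calc Real.sqrt (7200 * (L : ℝ) ^ 6) ^ 3 = Real.sqrt (7200 * (L : ℝ) ^ 6) ^ 2 * Real.sqrt (7200 * (L : ℝ) ^ 6) := by ring
      _ ≤ (7200 * (L : ℝ) ^ 6) * (7200 * (L : ℝ) ^ 6) := by rw [hsq2]; exact mul_le_mul_of_nonneg_left hsqle (by positivity)
      _ = (7200 * (L : ℝ) ^ 6) ^ 2 := by ring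
  have he : Real.exp 1 ≤ 3 := by have := Real.exp_one_lt_d9; linarith
  have hB0 : 0 ≤ B ^ (7 / 2 : ℝ) := Real.rpow_nonneg (by linarith) _
  have hI0 : 0 ≤ (Real.sqrt ((1 / 4 : ℝ) * (1 / (1800 * (L : ℝ) ^ 6))) ^ 3)⁻¹ := by positivity
  calc Real.exp 1 * B ^ (7 / 2 : ℝ) * (Real.sqrt ((1 / 4 : ℝ) * (1 / (1800 * (L : ℝ) ^ 6))) ^ 3)⁻¹ * (2 * (1800 * (L : ℝ) ^ 6) ^ 2)
      ≤ 3 * ((19 * 20400) ^ 4 * (L : ℝ) ^ 32) * ((7200 * (L : ℝ) ^ 6) ^ 2) * (2 * (1800 * (L : ℝ) ^ 6) ^ 2) :=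
        mul_le_mul_of_nonneg_right (mul_le_mul (mul_le_mul he hB72 hB0 (by norm_num)) hinv hI0 (by positivity)) (by positivity)
    _ = 3 * (19 * 20400) ^ 4 * 7200 ^ 2 * (2 * 1800 ^ 2) * (L : ℝ) ^ 56 := by ring

/-- The matching letter and radius are polynomial: `δr(L) ≤ 12·122689728·2304·36·L¹⁸` and `ρO(L)⁻¹ ≤ 12·44712000·2304·36·L¹⁸` (`|Fol L| ≤ 6L⁴`). [folklore] -/
theorem tipDeltaR_facts :
    (12 * 122689728 * 2304 * (Fintype.card (Fol L) : ℝ) ^ 2 * (L : ℝ) ^ 10) ≤ 12 * 122689728 * 2304 * 36 * (L : ℝ) ^ 18 ∧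
    ((12 * (Fintype.card (Fol L) : ℝ) * 44712000 * (L : ℝ) ^ 4 * (2304 * (L : ℝ) ^ 6 * (Fintype.card (Fol L) : ℝ)))⁻¹)⁻¹ ≤
      12 * 44712000 * 2304 * 36 * (L : ℝ) ^ 18 := by
  obtain ⟨hL1, hc1, hc6, -, -⟩ := cell_sizes (L := L)
  have hL0 : (0 : ℝ) < L := by linarith
  set n : ℝ := (Fintype.card (Fol L) : ℝ) with hn
  have hn2 : n ^ 2 ≤ 36 * (L : ℝ) ^ 8 := by nlinarith
  refine ⟨?_, ?_⟩
  · have h0 : 0 ≤ (L : ℝ) ^ 10 := by positivity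
    nlinarith [mul_le_mul_of_nonneg_right hn2 h0]
  · rw [inv_inv]
    have e : 12 * n * 44712000 * (L : ℝ) ^ 4 * (2304 * (L : ℝ) ^ 6 * n) = 12 * 44712000 * 2304 * (n ^ 2 * (L : ℝ) ^ 10) := by ring
    rw [e]
    have h0 : 0 ≤ (L : ℝ) ^ 10 := by positivity
    nlinarith [mul_le_mul_of_nonneg_right hn2 h0]

omit [NeZero L] in
/-- The shell weight of `[a, 2a]` (`a ≥ 1`): `7/(96·a³) ≤ W′(a, 2a) = (2a/(1+4a²) − a/(1+a²) + (arctan 2a − arctan a))/2`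
(✓`integral_Icc_inv_one_add_sq_sq_ge`: `(a⁻³ − (2a)⁻³)/12`). [folklore] -/
theorem tipShellWeight_ge {a : ℝ} (ha : 1 ≤ a) :
    7 / (96 * a ^ 3) ≤ ((2 * a) / (1 + (2 * a) ^ 2) - a / (1 + a ^ 2) + (Real.arctan (2 * a) - Real.arctan a)) / 2 := by
  have h := integral_Icc_inv_one_add_sq_sq_ge ha (by linarith : a ≤ 2 * a)
  rw [integral_Icc_inv_one_add_sq_sq (by linarith : a ≤ 2 * a)] at h
  have ha0 : 0 < a := by linarith
  have e : (a⁻¹ ^ 3 - (2 * a)⁻¹ ^ 3) / 12 = 7 / (96 * a ^ 3) := by field_simp; ring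
  linarith [e.symm.le, e.le]

omit [NeZero L] in
/-- The tip letter cut `δ_τ = √(τ⁻¹ − 1)` for `0 < τ ≤ ½`: `1 ≤ δ_τ`, `δ_τ⁻¹ ≤ √2·√τ`, and `δ_τ^{−3/4} ≤ 2·τ^{3/8}`. [folklore] -/
theorem tipDeltaTau_facts {τ : ℝ} (hτ : 0 < τ) (hτ2 : τ ≤ 1 / 2) :
    1 ≤ Real.sqrt (τ⁻¹ - 1) ∧ (Real.sqrt (τ⁻¹ - 1))⁻¹ ≤ Real.sqrt 2 * Real.sqrt τ ∧ Real.sqrt (τ⁻¹ - 1) ^ (-(3 / 4 : ℝ)) ≤ 2 * τ ^ (3 / 8 : ℝ) := by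
  have hτi : 2 ≤ τ⁻¹ := by rw [le_inv_comm₀ (by norm_num) hτ]; simpa using hτ2
  have h1 : 1 ≤ τ⁻¹ - 1 := by linarith
  -- `(2τ)⁻¹ ≤ τ⁻¹ − 1`
  have hlow : (2 * τ)⁻¹ ≤ τ⁻¹ - 1 := by
    rw [mul_inv, show (2 : ℝ)⁻¹ * τ⁻¹ = τ⁻¹ / 2 by ring]; linarith
  have h2τ : 0 < 2 * τ := by positivity
  have hδ1 : 1 ≤ Real.sqrt (τ⁻¹ - 1) := Real.one_le_sqrt.2 h1
  have hδ0 : 0 < Real.sqrt (τ⁻¹ - 1) := by linarith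
  have hδlow : Real.sqrt ((2 * τ)⁻¹) ≤ Real.sqrt (τ⁻¹ - 1) := Real.sqrt_le_sqrt hlow
  have hs2 : Real.sqrt ((2 * τ)⁻¹) = (Real.sqrt 2 * Real.sqrt τ)⁻¹ := by
    rw [Real.sqrt_inv, Real.sqrt_mul (by norm_num)]
  have hpos : 0 < Real.sqrt 2 * Real.sqrt τ := mul_pos (Real.sqrt_pos.2 (by norm_num)) (Real.sqrt_pos.2 hτ)
  refine ⟨hδ1, ?_, ?_⟩
  · rw [hs2] at hδlow
    rw [inv_le_comm₀ hδ0 hpos]; exact hδlow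
  · -- `δ_τ^{-3/4} ≤ ((2τ)^{-1/2})^{-3/4} = (2τ)^{3/8} ≤ 2 τ^{3/8}`
    have hδrp : Real.sqrt (τ⁻¹ - 1) ^ (-(3 / 4 : ℝ)) ≤ Real.sqrt ((2 * τ)⁻¹) ^ (-(3 / 4 : ℝ)) :=
      Real.rpow_le_rpow_of_nonpos (Real.sqrt_pos.2 (by positivity)) hδlow (by norm_num)
    have e : Real.sqrt ((2 * τ)⁻¹) ^ (-(3 / 4 : ℝ)) = (2 * τ) ^ (3 / 8 : ℝ) := by
      rw [Real.sqrt_eq_rpow, Real.inv_rpow h2τ.le, ← Real.rpow_neg_one, ← Real.rpow_mul h2τ.le, ← Real.rpow_mul h2τ.le]; norm_num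
    have h3 : (2 * τ) ^ (3 / 8 : ℝ) ≤ 2 * τ ^ (3 / 8 : ℝ) := by
      rw [Real.mul_rpow (by norm_num) hτ.le]
      have h4 : (2 : ℝ) ^ (3 / 8 : ℝ) ≤ 2 := by
        have := Real.rpow_le_rpow_of_exponent_le (by norm_num : (1:ℝ) ≤ 2) (by norm_num : (3 / 8 : ℝ) ≤ 1)
        rwa [Real.rpow_one] at this
      exact mul_le_mul_of_nonneg_right h4 (Real.rpow_nonneg hτ.le _)
    exact (hδrp.trans e.le).trans h3

end Summit.QuantumFields.YangMills.Theorems.SwapVirialDeficit.SectorLaplace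

end
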